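import Mathlib
import Literature.NumberTheory.Transcendental.KZCalculusProofs
import Literature.NumberTheory.Transcendental.KZLogCalculusProofs
import Literature.NumberTheory.Transcendental.KZSemiCanonicalReductionProofs
import Literature.NumberTheory.Transcendental.KZDominatedFamilyRelations
import Literature.NumberTheory.Transcendental.KZSemialgebraicComplex
import Literature.NumberTheory.Transcendental.KZIdealTetrahedron
import Literature.NumberTheory.Transcendental.KZIntervalPeriodProofs
import Summits.KontsevichZagierPeriods.KontsevichZagierPeriods.Theorems.HyperbolicBlochOffTetraSectorKernelStubAffineOrbit
import Summits.KontsevichZagierPeriods.KontsevichZagierPeriods.Theorems.TorsionLogsTriangleConcatenation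

/-!
# OffTetraSectorKernel (stmt-KontsevichZagierPeriods-10557), line odd-hyperbolic-ladder: stub `stub_eulerReflection`

EULER'S REFLECTION FORMULA `Li₂(x) + Li₂(1−x) + log x · log(1−x) = Li₂(1)` INSIDE THE
KONTSEVICH–ZAGIER CALCULUS, for real algebraic `0 < x < 1`, with
`Li₂(a) = ∬_{0<v<u<a} du dv/(u(1−v))` and `log x · log(1−x) = ∬_{x<u<1, 0<v<x} du dv/(u(1−v))`.

Proof (rules (1a) and (2) only). All four representations carry the integrand
`f(u, v) = 1/(u(1−v))` on their domains. The `Li₂(1)`-triangle `T = {0<v<u<1}` is the disjoint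
union of the `Li₂(x)`-triangle `P₁ = {0<v<u<x}`, the rectangle `P₂ = {x<u<1, 0<v<x}`, the triangle
`P₃ = {x<v<u<1}` and the two NULL segments `T ∩ {u = x}`, `T ∩ {v = x}`; this is exactly Chen's
concatenation dissection of an ordered triangle for the product integrand `(1−v)⁻¹ · u⁻¹`
(`triangleConcatenation_proof` of route TorsionLogs: iterated rule (1a) plus null pieces), giving
`[T] ≡ [P₁] + [P₃] + [P₂]`, the piece on `P₃` being the restriction of the given `Li₂(1)`
representation. Finally the affine involution `ι(u, v) = (1−v, 1−u)` (matrix `!![0, -1; -1, 0]`,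
translation `(1, 1)`, `|det| = 1`) maps `P₃` onto the `Li₂(1−x)`-triangle `{0<v'<u'<1−x}` and
`f(ι(u, v)) = 1/((1−v)u) = f(u, v)`, so `[P₃] ≡ [Li₂(1−x)-triangle]` is ONE change of variables
(`aff_orbit_of_sub_of_mem_changeOfVariablesRel`, rule (2)).

References: M. Kontsevich, D. Zagier, *Periods* (2001), §1.2, rules (1), (2).
-/

noncomputable section

open Set MeasureTheory
open Literature.NumberTheory.Transcendental Literature.ModelTheory.ExponentialFields

namespace Summit.KontsevichZagierPeriods.HyperbolicBloch.OffTetraSectorKernel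

/-! ### The upper piece -/

/-- The upper triangle `{x < v < u < 1}` is `ℚ`-semialgebraic for real-algebraic `x` (real
algebraic constants are `ℚ`-definable). [cite: KontsevichZagier2001, §1.1] -/
theorem eulerReflection_isSemialgebraic_upper {x : ℝ} (hx : IsAlgebraic ℚ x) :
    IsSemialgebraic ℚ {w : Fin 2 → ℝ | x < w 1 ∧ w 1 < w 0 ∧ w 0 < 1} := by
  have hU : IsSemialgebraic ℚ (univ : Set (Fin 2 → ℝ)) := isSemialgebraic_univ
  have hco : ∀ i : Fin 2, IsSemialgebraicFunOn ℚ (univ : Set (Fin 2 → ℝ)) (fun p => p i) :=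
    fun i => isSemialgebraicFunOn_apply hU i
  have S1 : IsSemialgebraic ℚ {p : Fin 2 → ℝ | x < p 1} :=
    isSemialgebraic_setOf_lt_of_isSemialgebraicFunOn
      (isSemialgebraicFunOn_const_of_isAlgebraic hU hx) (hco 1)
  have S2 : IsSemialgebraic ℚ {p : Fin 2 → ℝ | p 1 < p 0} :=
    isSemialgebraic_setOf_lt_of_isSemialgebraicFunOn (hco 1) (hco 0)
  have S3 : IsSemialgebraic ℚ {p : Fin 2 → ℝ | p 0 < 1} :=
    isSemialgebraic_setOf_lt_of_isSemialgebraicFunOn (hco 0)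
      (isSemialgebraicFunOn_const_of_isAlgebraic hU isAlgebraic_one)
  convert S1.inter (S2.inter S3) using 1
  ext w
  simp only [mem_inter_iff, mem_setOf_eq]

/-! ### The involution `ι(u, v) = (1 − v, 1 − u)` as an affine map -/

/-- The involution `ι(u, v) = (1 − v, 1 − u)` is the affine map with matrix `!![0, -1; -1, 0]` and
translation `(1, 1)`. [folklore] -/
theorem eulerReflection_affine_apply (w : Fin 2 → ℝ) :
    (!![(0 : ℝ), -1; -1, 0] : Matrix (Fin 2) (Fin 2) ℝ).mulVec w + (fun _ => (1 : ℝ)) =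
      ![1 - w 1, 1 - w 0] := by
  ext i
  fin_cases i <;> simp [dotProduct, Fin.sum_univ_two] <;> ring

/-- The matrix `!![0, -1; -1, 0]` has real-algebraic (integer) entries. [folklore] -/
theorem eulerReflection_matrix_isAlgebraic :
    ∀ j l : Fin 2, IsAlgebraic ℚ ((!![(0 : ℝ), -1; -1, 0] : Matrix (Fin 2) (Fin 2) ℝ) j l) := by
  intro j l
  fin_cases j <;> fin_cases l
  · simpa using isAlgebraic_zero
  · simpa using isAlgebraic_one.neg
  · simpa using isAlgebraic_one.neg
  · simpa using isAlgebraic_zero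

/-- `det !![0, -1; -1, 0] = -1`. [folklore] -/
theorem eulerReflection_matrix_det :
    ((!![(0 : ℝ), -1; -1, 0] : Matrix (Fin 2) (Fin 2) ℝ)).det = -1 := by
  rw [Matrix.det_fin_two_of]
  ring

/-- The involution `ι(u, v) = (1 − v, 1 − u)` maps the upper triangle `{x < v < u < 1}` onto the
`Li₂(1 − x)`-triangle `{0 < v' < u' < 1 − x}`. [folklore] -/
theorem eulerReflection_image (x : ℝ) :
    (fun w : Fin 2 → ℝ => (![1 - w 1, 1 - w 0] : Fin 2 → ℝ)) ''
        {w | x < w 1 ∧ w 1 < w 0 ∧ w 0 < 1} =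
      {w | 0 < w 1 ∧ w 1 < w 0 ∧ w 0 < 1 - x} := by
  ext u
  simp only [mem_image, mem_setOf_eq]
  constructor
  · rintro ⟨w, ⟨h1, h2, h3⟩, rfl⟩
    simp only [Matrix.cons_val_zero, Matrix.cons_val_one]
    exact ⟨by linarith, by linarith, by linarith⟩
  · rintro ⟨h1, h2, h3⟩
    refine ⟨![1 - u 1, 1 - u 0], ?_, ?_⟩
    · simp only [Matrix.cons_val_zero, Matrix.cons_val_one]
      exact ⟨by linarith, by linarith, by linarith⟩
    · ext i
      fin_cases i <;> simp

/-! ### The stub -/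

/-- STUB `stub_eulerReflection`: EULER'S REFLECTION FORMULA `Li₂(x) + Li₂(1−x) + log x·log(1−x) = Li₂(1)` INSIDE THE
CALCULUS, for real algebraic `0 < x < 1`. The `Li₂(1)`-triangle `{0<v<u<1}` (integrand `1/(u(1−v))` throughout) is, up
to the null lines `u = x`, `v = x`, the disjoint union of the `Li₂(x)`-triangle `{0<v<u<x}`, the rectangle
`{x<u<1, 0<v<x}` (value `log x · log(1−x)`) and the triangle `{x<v<u<1}`, and the last is carried onto the
`Li₂(1−x)`-triangle `{0<v<u<1−x}` by the involution `(u,v) ↦ (1−v, 1−u)`, which preserves `du dv/(u(1−v))`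
(rules (1a), (2)). [cite: KontsevichZagier2001, §1.2] -/
theorem stub_eulerReflection :
    ∀ (x : ℝ), IsAlgebraic ℚ x → 0 < x → x < 1 →
    ∀ (L₁ Lx Px Lx' : KZ.IntegralRep 2),
      L₁.domain = {w | 0 < w 1 ∧ w 1 < w 0 ∧ w 0 < 1} →
      Set.EqOn L₁.integrand (fun w => 1 / (w 0 * (1 - w 1))) L₁.domain →
      Lx.domain = {w | 0 < w 1 ∧ w 1 < w 0 ∧ w 0 < x} →
      Set.EqOn Lx.integrand (fun w => 1 / (w 0 * (1 - w 1))) Lx.domain →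
      Px.domain = {w | x < w 0 ∧ w 0 < 1 ∧ 0 < w 1 ∧ w 1 < x} →
      Set.EqOn Px.integrand (fun w => 1 / (w 0 * (1 - w 1))) Px.domain →
      Lx'.domain = {w | 0 < w 1 ∧ w 1 < w 0 ∧ w 0 < 1 - x} →
      Set.EqOn Lx'.integrand (fun w => 1 / (w 0 * (1 - w 1))) Lx'.domain →
      KZ.of L₁ - KZ.of Lx - KZ.of Px - KZ.of Lx' ∈ KZ.relations := by
  intro x hx hx0 hx1 L₁ Lx Px Lx' hL₁ hL₁i hLx hLxi hPx hPxi hLx' hLx'i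
  -- the third piece: the restriction of `L₁` to the upper triangle `P₃ = {x < v < u < 1}`
  have hP₃T : {w : Fin 2 → ℝ | x < w 1 ∧ w 1 < w 0 ∧ w 0 < 1} ⊆ L₁.domain := by
    rw [hL₁]
    rintro w ⟨h1, h2, h3⟩
    exact ⟨by linarith, h2, h3⟩
  set R₃ : KZ.IntegralRep 2 := L₁.restrict _ (eulerReflection_isSemialgebraic_upper hx) hP₃T
    with hR₃
  -- rule (1a): `[L₁] ≡ [Lx] + [R₃] + [Px]` off the null lines `u = x`, `v = x` (Chen's
  -- concatenation dissection of the ordered triangle, product integrand `(1 − v)⁻¹ · u⁻¹`)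
  have hprod : ∀ R : KZ.IntegralRep 2,
      EqOn R.integrand (fun w => 1 / (w 0 * (1 - w 1))) R.domain →
      EqOn R.integrand (fun w => (fun t : ℝ => (1 - t)⁻¹) (w 1) * (fun t : ℝ => t⁻¹) (w 0))
        R.domain := fun R hR w hw => by
    rw [hR hw]
    simp only [one_div, mul_inv_rev]
  have hPx' : Px.domain = {w | 0 < w 1 ∧ w 1 < x ∧ x < w 0 ∧ w 0 < 1} := by
    rw [hPx]
    ext w
    simp only [mem_setOf_eq]
    tauto
  have hsplit : KZ.of L₁ - KZ.of Lx - KZ.of R₃ - KZ.of Px ∈ KZ.relations :=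
    Summit.KontsevichZagierPeriods.KontsevichZagierPeriods.Theorems.triangleConcatenation_proof 0 x
      1 (fun t => (1 - t)⁻¹) (fun t => t⁻¹) hx0 hx1 L₁ Lx R₃ Px hL₁ hLx rfl hPx' (hprod L₁ hL₁i)
      (hprod Lx hLxi) (hprod R₃ fun w hw => hL₁i (hP₃T hw)) (hprod Px hPxi)
  -- rule (2): the involution `ι(u, v) = (1 − v, 1 − u)` carries `R₃` onto `Lx'`
  have hmove : KZ.of R₃ - KZ.of Lx' ∈ KZ.relations := by
    refine KZ.changeOfVariablesRel_subset_relations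
      (aff_orbit_of_sub_of_mem_changeOfVariablesRel (!![(0 : ℝ), -1; -1, 0]) (fun _ => (1 : ℝ))
        eulerReflection_matrix_isAlgebraic (fun _ => isAlgebraic_one)
        (by rw [eulerReflection_matrix_det]; norm_num) R₃ Lx' ?_ ?_)
    · rw [hR₃, KZ.IntegralRep.domain_restrict, hLx',
        show (fun w : Fin 2 → ℝ =>
            (!![(0 : ℝ), -1; -1, 0] : Matrix (Fin 2) (Fin 2) ℝ).mulVec w + fun _ => (1 : ℝ)) =
          fun w => ![1 - w 1, 1 - w 0] from funext eulerReflection_affine_apply]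
      exact (eulerReflection_image x).symm
    · intro w hw
      have hwP : w ∈ {w : Fin 2 → ℝ | x < w 1 ∧ w 1 < w 0 ∧ w 0 < 1} := by
        simpa only [hR₃, KZ.IntegralRep.domain_restrict] using hw
      have hιw : (!![(0 : ℝ), -1; -1, 0] : Matrix (Fin 2) (Fin 2) ℝ).mulVec w +
          (fun _ => (1 : ℝ)) ∈ Lx'.domain := by
        rw [eulerReflection_affine_apply, hLx']
        obtain ⟨h1, h2, h3⟩ := hwP
        simp only [mem_setOf_eq, Matrix.cons_val_zero, Matrix.cons_val_one]
        exact ⟨by linarith, by linarith, by linarith⟩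
      rw [hR₃, KZ.IntegralRep.integrand_restrict, hL₁i (hP₃T hwP), hLx'i hιw,
        eulerReflection_affine_apply, eulerReflection_matrix_det]
      simp only [Matrix.cons_val_zero, Matrix.cons_val_one, abs_neg, abs_one, mul_one]
      ring
  -- bookkeeping
  have : KZ.of L₁ - KZ.of Lx - KZ.of Px - KZ.of Lx' =
      (KZ.of L₁ - KZ.of Lx - KZ.of R₃ - KZ.of Px) + (KZ.of R₃ - KZ.of Lx') := by abel
  rw [this]
  exact KZ.relations.add_mem hsplit hmove

end Summit.KontsevichZagierPeriods.HyperbolicBloch.OffTetraSectorKernel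

end
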